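import Literature.NumberTheory.LFunctions.BurnolSonineIndexTheoremsProofs
import Literature.NumberTheory.LFunctions.BurnolSonineHardyCharacterisationProofs
import Literature.NumberTheory.LFunctions.BurnolSonineHardy
import Literature.NumberTheory.LFunctions.BurnolZetaEvaluatorsMinimality
import Literature.NumberTheory.LFunctions.ZetaZerosProofs
import HarnessLib

/-!
# Burnol 2004 (JTNB), Prop. 6.5 — the completeness half at `a = 1` from Prop. 6.1, by the
# multiplier `(s−ρ₁)(s−ρ₂)/(s(s−1))` ("we have used that `F(0) = 0` and that `F(s)` has no pole at `s = 1`")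

LINE 1 — LABEL: RH-FREE (Hilbert-space bookkeeping in Burnol's Sonine spaces `K_1 ⊂ L_1 ⊂ L²`; the
evaluator systems are indexed by the non-trivial zeros of `ζ` WHEREVER they lie; no hypothesis and no
conclusion about their location). FRAMING (cell rh-crit, D-0074): corpus theorems are RH-FREE literature;
nothing here is worded as progress toward RH. bears_on: B-C/B-P (LADDER-RH COLUMN 6, de Branges framework).
WHAT THIS IS NOT: not a route, not a criterion, no positivity at `E_ζ`; an implication between two
as-printed statements of a 2004 paper moves RH by nothing. Nothing here bears on the truth of RH.

Source: J.-F. Burnol, *Two complete and minimal systems associated with the zeros of the Riemann zeta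
function*, J. Théor. Nombres Bordeaux 16 (2004) 65–94 = arXiv:math/0203120v7 [Burnol2004b], §6,
Prop. 6.5 (p. 16, TeX of record `dbl/src/Burnol2004JTNB_arXivmath0203120v7.tex` l.1303–1328):

> "The vectors `Z¹_{ρ,k}` are not minimal in `K_1`. In fact `K_1` is spanned by these vectors even
> after omitting `Z¹_{ρ₁,m_{ρ₁}−1}` and `Z¹_{ρ₂,m_{ρ₂}−1}` (`ρ₁ ≠ ρ₂`), or `Z¹_{ρ,m_ρ−1}` and
> `Z¹_{ρ,m_ρ−2}` (`m_ρ ≥ 2`), from the list. This shortened system is then a minimal system.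
> *Proof.* If `f` in `K_1` is perpendicular (for the form `[f,g] = ∫₁^∞ f(t)g(t)dt`) to this shortened
> list of evaluators then its right Mellin transform factorizes as
> `F(s) = s(s−1)ζ(s)/((s−ρ₁)(s−ρ₂)) · θ(s)` where we have used that `F(0) = 0` and that `F(s)` has no
> pole at `s = 1`. … The proof then proceeds as above [= the proof of Prop. 6.1] and leads to
> `F(s) = 0`."

This theorem-only module (0 definitions, 0 named facts) proves the COMPLETENESS and NON-MINIMALITY
clauses of Prop. 6.5 from the `a = 1` clause of Prop. 6.1 (`Burnol2004b_prop6_1`, the completeness of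
the `Y¹_{ρ,k}` in `L_1` — "proceeds as above"), by making the printed reduction explicit as a
MULTIPLIER: for `f ∈ K_1` annihilated by the shortened list, the function
`û(s) = F(s)·(s−ρ₁)(s−ρ₂)/(s(s−1))` is again the Mellin transform of an element `u ∈ L_1` (repaired
Prop. 4.1 (ii), tree theorem `Burnol2004b_prop4_1R_ii`; the two facts "`F(0) = 0`", "no pole at `1`" for
`f ∈ K_1` are exactly what makes `û` regular off `s = 1` with at most a simple pole there), and the two
missing vanishing orders at `ρ₁, ρ₂` are restored by the simple zeros of the multiplier, so that `u` is
annihilated by ALL the `Y¹_{ρ,k}`; Prop. 6.1 (`a = 1`) gives `u = 0`, hence `f = 0`. The MINIMALITY of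
the shortened system (last sentence of Prop. 6.5, the vectors `s(s−1)ζ(s)/((s−ρ₁)(s−ρ₂)(s−ρ)^l)`) is
NOT proved here (it is the sibling module `BurnolZetaShortenedSystemMinimalProofs.lean` of cell
rh-crit/dbl, row R52); the assembled door `Burnol2004b_prop6_5_of_complete_of_minimal` takes it as an
explicit hypothesis, in exactly that module's shape.

## What is proved

* `BurnolShortenedComplete.burnolEval_conj_eq_zero_of_inner_eq_zero` — Hermitian orthogonality `⟪Z^a_{ρ,k}, g⟫ = 0`
  is the vanishing `M(ḡ)^{(k)}(ρ) = 0` of the evaluation of the conjugate `ḡ` (`[·,·]` vs `⟪·,·⟫`);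
* `BurnolShortenedComplete.natCast_le_analyticOrderAt_completedMellinEntire` — vanishing evaluations
  `M(v)^{(k)}(ρ) = 0`, `k < n`, give `ord_ρ 𝒢_v ≥ n` for the entire completed transform `𝒢_v` (Thm. 2.1);
* `BurnolShortenedComplete.norm_multiplier_le` — `(s−α)(s−β)/(s(s−1))` is bounded on `Re s > 1/2` off a
  rectangle around `s = 1`;
* `BurnolShortenedComplete.exists_mem_sonineL_multiplier` — for `v ∈ K_1` and any `α, β ∈ ℂ` there is
  `u ∈ L_1` with `M(u)(s) = 𝒢_v(s)·(s−α)(s−β)/(s(s−1))` off `{0, 1} ∪ −2ℕ` (Prop. 4.1 (ii) with the Hardy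
  data of `v` and `𝓕v` and the functional equation `𝒢_{𝓕v}(s) = 𝒢_v(1−s)`);
* `BurnolShortenedComplete.eq_zero_of_le_analyticOrderAt_mul` — if the `Y¹_{ρ,k}` are complete in `L_1` and
  `𝒢_v·(s−α)(s−β)/(s(s−1))` vanishes to order `≥ m_ρ` at every non-trivial zero, then `v = 0`;
* `BurnolShortenedComplete.isCompleteSystemIn_shortened` — **Prop. 6.5, completeness clause**: for every
  admissible omission `{p, q}` the shortened system `(Z¹_r)_{r ≠ p, q}` is complete in `K_1`, GIVEN the
  `a = 1` clause of Prop. 6.1;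
* `BurnolShortenedComplete.not_isMinimalSystem_of_complete` — **Prop. 6.5, first clause**: the full system
  `(Z¹_{ρ,k})` is then NOT minimal (two distinct zeros exist: Hardy);
* `Burnol2004b_prop6_5_of_complete_of_minimal`, `Burnol2004b_prop6_5_of_prop6_1_of_minimal` — the doors:
  Prop. 6.5 AS TYPED from (Prop. 6.1 at `a = 1`) + (minimality of the shortened systems).

Deviation from print: none in substance — print's `θ = F(s)(s−ρ₁)(s−ρ₂)/(s(s−1)ζ(s))` is our `û/ζ`, and
"proceeds as above" (the Kreĭn/Paley–Wiener argument of Prop. 6.1 at `a = 1`) is consumed as the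
STATEMENT of Prop. 6.1 at `a = 1` applied to `u`, rather than re-run.

## References
* [Burnol2004b] Prop. 6.5 (TeX l.1303–1328), Prop. 6.1 (l.1203–1239), Prop. 4.1 (l.633–669),
  Thm. 2.1 / Prop. 2.2 (l.437–469), §2 evaluators (l.472–484).
* [Hardy1914] G. H. Hardy, C. R. Acad. Sci. Paris 158 (1914) 1012–1014 (two distinct zeros; tree
  `Hardy.riemannZeta_zeros_on_critical_line_infinite`).
-/

noncomputable section

open MeasureTheory Complex Filter Set
open scoped ComplexConjugate Topology InnerProductSpace FourierTransform

namespace Literature.NumberTheory.LFunctions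

namespace BurnolShortenedComplete

open BurnolEvaluators BurnolSonineIndex BurnolZetaEvaluators BurnolSonineHardy

/-! ## A. Non-trivial zeros are admissible evaluation points -/

/-- A non-trivial zero `ρ` satisfies `ρ ≠ 0`, `ρ ≠ 1`, `0 < Re ρ < 1` and `Γ_ℝ(ρ) ≠ 0`. [cite: Burnol2004b, §2 Definition (arXiv:math/0203120v7 p. 5, TeX l.486–491)] -/
theorem zero_facts {ρ : ℂ} (hρ : ρ ∈ ZetaZeros.riemannZetaNontrivialZeros) :
    ρ ≠ 0 ∧ ρ ≠ 1 ∧ 0 < ρ.re ∧ ρ.re < 1 ∧ Gammaℝ ρ ≠ 0 := by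
  obtain ⟨-, h0, h1⟩ := mem_riemannZetaNontrivialZeros_iff_holds.1 hρ
  obtain ⟨hρ0, hρ1, -⟩ := admissible_of_mem_nontrivialZeros hρ
  exact ⟨hρ0, hρ1, h0, h1, Gammaℝ_ne_zero_of_re_pos h0⟩

/-! ## B. From Hermitian orthogonality to vanishing evaluations -/

/-- **`⟪Z^a_{ρ,k}, g⟫ = 0` means `M(ḡ)^{(k)}(ρ) = 0`** (`g ∈ K_a`, `ḡ` its complex conjugate, which lies in
`K_a` again): `⟪g, Z⟫ = 2∫₀^∞ ḡ·Z = 2[ḡ, Z] = 2·M(ḡ)^{(k)}(ρ)` by the defining property of the evaluator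
for the BILINEAR form. [cite: Burnol2004b, §2 (arXiv:math/0203120v7 p. 5, TeX l.472–484)] -/
theorem burnolEval_conj_eq_zero_of_inner_eq_zero {a : ℝ} (ha : 0 < a)
    {g v : Lp ℂ 2 (volume : Measure ℝ)} (hg : g ∈ sonineK a)
    (hv : (v : ℝ → ℂ) =ᵐ[volume] fun x ↦ conj ((g : ℝ → ℂ) x)) (p : ZetaZeroIndex)
    (h : ⟪burnolZSystem a p, g⟫_ℂ = 0) : burnolEval v p.1.1 p.1.2 = 0 := by
  have hZ := isBurnolZ_burnolZSystem ha p
  have hvK : v ∈ sonineK a := mem_sonineK_of_conj hg hv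
  have h1 : ⟪g, burnolZSystem a p⟫_ℂ = 0 := by
    rw [← inner_conj_symm, h, map_zero]
  rw [inner_eq_setIntegral_Ioi hg.1 hZ.1.1 hv] at h1
  have h2 : ∫ t in Ioi (0 : ℝ), (burnolZSystem a p : ℝ → ℂ) t * (((2 : ℂ) • v : Lp ℂ 2 (volume : Measure ℝ)) : ℝ → ℂ) t
      = 2 * ∫ t in Ioi (0 : ℝ), (v : ℝ → ℂ) t * (burnolZSystem a p : ℝ → ℂ) t := by
    rw [← integral_const_mul]
    refine integral_congr_ae ((ae_restrict_of_ae (Lp.coeFn_smul (2 : ℂ) v)).mono fun t ht ↦ ?_)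
    simp only [ht, Pi.smul_apply, smul_eq_mul]
    ring
  rw [h2, hZ.2 v hvK] at h1
  exact (mul_eq_zero.1 h1).resolve_left two_ne_zero

/-! ## C. Vanishing evaluations give the analytic order of `𝒢_v` -/

/-- For `v ∈ K_a` and a non-trivial zero `ρ`: if `M(v)^{(k)}(ρ) = 0` for all `k < n` then the entire
completed transform `𝒢_v` (Thm. 2.1) vanishes at `ρ` to order `≥ n` (near `ρ`, `𝒢_v = Γ_ℝ·G_v = M(v)`).
[cite: Burnol2004b, Thm. 2.1 (arXiv:math/0203120v7 p. 5, TeX l.437–443)] -/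
theorem natCast_le_analyticOrderAt_completedMellinEntire {a : ℝ} (ha : 0 < a)
    {v : Lp ℂ 2 (volume : Measure ℝ)} (hv : v ∈ sonineK a)
    {ρ : ℂ} (hρ : ρ ∈ ZetaZeros.riemannZetaNontrivialZeros) {n : ℕ}
    (h : ∀ k < n, burnolEval v ρ k = 0) :
    (n : ℕ∞) ≤ analyticOrderAt (completedMellinEntire (v : ℝ → ℂ)) ρ := by
  obtain ⟨-, hρ1, -, -, hΓ⟩ := zero_facts hρ
  have han : AnalyticAt ℂ (completedMellinEntire (v : ℝ → ℂ)) ρ :=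
    ((hasCompletedMellinEntire_of_mem_sonineK ha hv).1.analyticAt ρ)
  rw [natCast_le_analyticOrderAt_iff_iteratedDeriv_eq_zero han]
  intro k hk
  have hev : completedMellinEntire (v : ℝ → ℂ) =ᶠ[𝓝 ρ] completedMellin (v : ℝ → ℂ) :=
    completedMellinEntire_eventuallyEq_completedMellin ha hv hρ1 hΓ
  rw [hev.iteratedDeriv_eq k]
  exact h k hk

/-! ## D. The multiplier `(s−α)(s−β)/(s(s−1))` -/

/-- **The multiplier is bounded on `Re s > 1/2` off the rectangle `3/4 ≤ Re s ≤ 5/4`, `|Im s| ≤ 1`**: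
there `|s| > 1/2` and `|s − 1| ≥ 1/4`, and for `|s| > 2` also `|s − 1| ≥ |s|/2`, whence
`|(s−α)(s−β)/(s(s−1))| ≤ 8(2 + |α|)(2 + |β|)`. [cite: Burnol2004b, Prop. 4.2, proof (arXiv:math/0203120v7 p. 8, TeX l.702–706)] -/
theorem norm_multiplier_le (α β : ℂ) {s : ℂ} (hs : 1 / 2 < s.re)
    (hoff : s.re < 3 / 4 ∨ 5 / 4 < s.re ∨ 1 < |s.im|) :
    ‖(s - α) * (s - β) / (s * (s - 1))‖ ≤ 8 * (2 + ‖α‖) * (2 + ‖β‖) := by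
  have hA : 0 ≤ ‖α‖ := norm_nonneg _
  have hB : 0 ≤ ‖β‖ := norm_nonneg _
  have hs0 : 1 / 2 < ‖s‖ := lt_of_lt_of_le hs (le_trans (le_abs_self _) (abs_re_le_norm s))
  have hs1 : 1 / 4 ≤ ‖s - 1‖ := by
    rcases hoff with h | h | h
    · have : 1 / 4 ≤ |(s - 1).re| := by
        rw [sub_re, one_re, abs_of_neg (by linarith)]; linarith
      exact this.trans (abs_re_le_norm _)
    · have : 1 / 4 ≤ |(s - 1).re| := by
        rw [sub_re, one_re, abs_of_pos (by linarith)]; linarith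
      exact this.trans (abs_re_le_norm _)
    · have : 1 / 4 ≤ |(s - 1).im| := by
        rw [sub_im, one_im, sub_zero]; linarith
      exact this.trans (abs_im_le_norm _)
  have hnum : ‖s - α‖ * ‖s - β‖ ≤ (‖s‖ + ‖α‖) * (‖s‖ + ‖β‖) :=
    mul_le_mul (norm_sub_le _ _) (norm_sub_le _ _) (norm_nonneg _) (by positivity)
  have hden : 0 < ‖s‖ * ‖s - 1‖ := by positivity
  rw [norm_div, norm_mul, norm_mul, div_le_iff₀ hden]
  by_cases hbig : ‖s‖ ≤ 2
  · -- small `|s|`: numerator ≤ (2+A)(2+B), denominator ≥ 1/8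
    calc ‖s - α‖ * ‖s - β‖ ≤ (‖s‖ + ‖α‖) * (‖s‖ + ‖β‖) := hnum
      _ ≤ (2 + ‖α‖) * (2 + ‖β‖) := by gcongr
      _ = 8 * (2 + ‖α‖) * (2 + ‖β‖) * ((1 / 2) * (1 / 4)) := by ring
      _ ≤ 8 * (2 + ‖α‖) * (2 + ‖β‖) * (‖s‖ * ‖s - 1‖) := by gcongr
  · -- large `|s|`: `|s - 1| ≥ |s|/2`
    have hbig : 2 < ‖s‖ := lt_of_not_ge hbig
    have hs1' : ‖s‖ / 2 ≤ ‖s - 1‖ := by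
      have h := norm_sub_norm_le s 1
      rw [norm_one] at h
      linarith
    have h1s : 1 ≤ ‖s‖ := by linarith
    calc ‖s - α‖ * ‖s - β‖ ≤ (‖s‖ + ‖α‖) * (‖s‖ + ‖β‖) := hnum
      _ ≤ (‖s‖ * (2 + ‖α‖)) * (‖s‖ * (2 + ‖β‖)) := by
          gcongr <;> nlinarith
      _ = 8 * (2 + ‖α‖) * (2 + ‖β‖) * (‖s‖ * (‖s‖ / 2)) / 4 := by ring
      _ ≤ 8 * (2 + ‖α‖) * (2 + ‖β‖) * (‖s‖ * (‖s‖ / 2)) := by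
          apply div_le_self (by positivity) (by norm_num)
      _ ≤ 8 * (2 + ‖α‖) * (2 + ‖β‖) * (‖s‖ * ‖s - 1‖) := by gcongr


/-- The multiplier is analytic off `{0, 1}`. [cite: Burnol2004b, Prop. 6.5, proof (arXiv:math/0203120v7 p. 16, TeX l.1312–1319)] -/
theorem analyticAt_multiplier (α β : ℂ) {z : ℂ} (hz0 : z ≠ 0) (hz1 : z ≠ 1) :
    AnalyticAt ℂ (fun s : ℂ ↦ (s - α) * (s - β) / (s * (s - 1))) z := by
  have hU : IsOpen {s : ℂ | s ≠ 0 ∧ s ≠ 1} := isOpen_ne.inter isOpen_ne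
  have hd : DifferentiableOn ℂ (fun s : ℂ ↦ (s - α) * (s - β) / (s * (s - 1))) {s : ℂ | s ≠ 0 ∧ s ≠ 1} :=
    ((differentiableOn_id.sub (differentiableOn_const α)).mul
      (differentiableOn_id.sub (differentiableOn_const β))).div
      (differentiableOn_id.mul (differentiableOn_id.sub (differentiableOn_const 1)))
      (fun s hs ↦ mul_ne_zero hs.1 (sub_ne_zero.2 hs.2))
  exact hd.analyticAt (hU.mem_nhds ⟨hz0, hz1⟩)

/-- **Order of the multiplier at a point `ρ ∉ {0, 1}`**: at least `[ρ = α] + [ρ = β]` (the simple zeros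
of the two linear factors). [cite: Burnol2004b, Prop. 6.5, proof (arXiv:math/0203120v7 p. 16, TeX l.1312–1319)] -/
theorem le_analyticOrderAt_multiplier (α β : ℂ) {ρ : ℂ} (hρ0 : ρ ≠ 0) (hρ1 : ρ ≠ 1) :
    (((if ρ = α then 1 else 0) + (if ρ = β then 1 else 0) : ℕ) : ℕ∞) ≤
      analyticOrderAt (fun s : ℂ ↦ (s - α) * (s - β) / (s * (s - 1))) ρ := by
  have hfun : (fun s : ℂ ↦ (s - α) * (s - β) / (s * (s - 1))) =
      (fun s : ℂ ↦ s - α) * (fun s : ℂ ↦ s - β) * (fun s : ℂ ↦ (s * (s - 1))⁻¹) := by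
    funext s
    simp only [Pi.mul_apply, div_eq_mul_inv]
  have h1 : AnalyticAt ℂ (fun s : ℂ ↦ s - α) ρ := analyticAt_id.sub analyticAt_const
  have h2 : AnalyticAt ℂ (fun s : ℂ ↦ s - β) ρ := analyticAt_id.sub analyticAt_const
  have h3 : AnalyticAt ℂ (fun s : ℂ ↦ (s * (s - 1))⁻¹) ρ :=
    (analyticAt_id.mul (analyticAt_id.sub analyticAt_const)).inv
      (mul_ne_zero hρ0 (sub_ne_zero.2 hρ1))
  -- order of a linear factor
  have hlin : ∀ γ : ℂ, (((if ρ = γ then 1 else 0) : ℕ) : ℕ∞) ≤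
      analyticOrderAt (fun s : ℂ ↦ s - γ) ρ := by
    intro γ
    split_ifs with h
    · have ha : AnalyticAt ℂ (fun s : ℂ ↦ s - γ) ρ := analyticAt_id.sub analyticAt_const
      rw [Nat.cast_one, ← ENat.coe_one, natCast_le_analyticOrderAt ha]
      exact ⟨fun _ ↦ 1, analyticAt_const, Eventually.of_forall fun z ↦ by simp [h]⟩
    · simp
  rw [hfun, analyticOrderAt_mul (h1.mul h2) h3, analyticOrderAt_mul h1 h2, Nat.cast_add]
  exact le_add_right (add_le_add (hlin α) (hlin β))

/-! ## E. The multiplied transform is again the Mellin transform of an element of `L_1` -/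

/-- **Hardy datum of the multiplied transform.** For `f ∈ K_1` with an ENTIRE continuation `G₀` of `f̂`
from the strip vanishing at `0` (Thm. 2.1), and any `α, β ∈ ℂ`, the function `G₀(s)(s−α)(s−β)/s²`
lies in `ℍ²(Re s > 1/2)`: it is the `ℍ²` function `((s−1)/s)·f̂(s)` of Prop. 4.1 (i) times the
multiplier `(s−α)(s−β)/(s(s−1))`, which is bounded off a compact rectangle around `s = 1`
(`norm_multiplier_le`, `IsHardyRight.of_le_off_rect`). Stated in the shape consumed by Prop. 4.1 (ii).
[cite: Burnol2004b, Prop. 4.1 (arXiv:math/0203120v7 p. 7, TeX l.633–655)] -/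
theorem exists_isHardyRight_multiplier {f : Lp ℂ 2 (volume : Measure ℝ)} (hf : f ∈ sonineK 1)
    {G₀ : ℂ → ℂ} (hG₀ : Differentiable ℂ G₀) (hG₀0 : G₀ 0 = 0)
    (hG₀eq : ∀ s : ℂ, 1 / 2 < s.re → s.re < 1 → G₀ s = rightMellin f s) (α β : ℂ) :
    ∃ F : ℂ → ℂ, IsHardyRight F ∧ ∀ s : ℂ, 1 / 2 < s.re → s ≠ 1 →
      F s = ((1 : ℝ) : ℂ) ^ s * ((s - 1) / s) * (dslope G₀ 0 s * ((s - α) * (s - β) / (s - 1))) := by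
  obtain ⟨F₁, hF₁, hF₁s⟩ := (Burnol2004b_prop4_1_i_strip one_pos (sonineK_subset_sonineL 1 hf)).1
  have hcont : HasRightMellinContinuation (f : ℝ → ℂ) G₀ := ⟨hG₀.differentiableOn, hG₀eq⟩
  have hEq := Burnol2004b_prop4_1_i_of_continuation one_pos hF₁ hF₁s hcont
  have hne0 : ∀ s : ℂ, 1 / 2 < s.re → s ≠ 0 := fun s hs h ↦ by
    rw [h, Complex.zero_re] at hs; linarith
  refine ⟨fun s ↦ G₀ s * ((s - α) * (s - β)) / s ^ 2, ?_, fun s hs hs1 ↦ ?_⟩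
  · have hdiff : DifferentiableOn ℂ (fun s ↦ G₀ s * ((s - α) * (s - β)) / s ^ 2)
        {s : ℂ | 1 / 2 < s.re} := by
      refine DifferentiableOn.div ?_ (differentiableOn_id.pow 2) fun s hs ↦ pow_ne_zero 2 (hne0 s hs)
      exact hG₀.differentiableOn.mul
        ((differentiableOn_id.sub (differentiableOn_const α)).mul
          (differentiableOn_id.sub (differentiableOn_const β)))
    refine hF₁.of_le_off_rect hdiff (σ₁ := 3 / 4) (σ₂ := 5 / 4) (R := 1)
      (C := 8 * (2 + ‖α‖) * (2 + ‖β‖)) (by norm_num) zero_le_one (by positivity) ?_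
    intro s hs hoff
    have hs0 : s ≠ 0 := hne0 s hs
    have hs1 : s ≠ 1 := by
      rintro rfl
      rcases hoff with h | h | h <;> norm_num at h
    have hF₁v : F₁ s = ((1 : ℝ) : ℂ) ^ s * ((s - 1) / s) * G₀ s := hEq ⟨hs, hs1⟩
    have hsub1 : s - 1 ≠ 0 := sub_ne_zero.2 hs1
    have hrew : G₀ s * ((s - α) * (s - β)) / s ^ 2 =
        ((s - α) * (s - β) / (s * (s - 1))) * F₁ s := by
      rw [hF₁v, ofReal_one, one_cpow, one_mul]
      field_simp
    rw [hrew, norm_mul]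
    exact mul_le_mul_of_nonneg_right (norm_multiplier_le α β hs hoff) (norm_nonneg _)
  · have hs0 : s ≠ 0 := hne0 s hs
    have hsub1 : s - 1 ≠ 0 := sub_ne_zero.2 hs1
    rw [ofReal_one, one_cpow, one_mul, dslope_of_ne _ hs0, slope_def_field, hG₀0, sub_zero, sub_zero]
    field_simp

/-- **`û := v̂·(s−α)(s−β)/(s(s−1))` is the Mellin transform of an element `u ∈ L_1`** (`v ∈ K_1`, any
`α, β`): Prop. 4.1 (ii) applied to `G(s) = G₀(s)(s−α)(s−β)/(s(s−1))` — holomorphic off `s = 1` because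
`G₀(0) = 0` (Thm. 2.1: "`F(0) = 0`"), with at most a simple pole at `1` ("`F(s)` has no pole at
`s = 1`") — and to its "Fourier transform" `H(s) = H₀(s)(s−(1−α))(s−(1−β))/(s(s−1))`, `H₀` the entire
continuation of `(𝓕v)^`, the functional equation coming from `𝒢_{𝓕v}(s) = 𝒢_v(1−s)`. Conclusions: the
strip identity for `û`, and `M(u)(s) = 𝒢_v(s)·(s−α)(s−β)/(s(s−1))` off `{0, 1} ∪ −2ℕ`.
[cite: Burnol2004b, Prop. 6.5, proof, with Prop. 4.1 and Thm. 2.1 (arXiv:math/0203120v7 pp. 5, 7, 16; TeX l.437–443, 633–669, 1312–1319)] -/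
theorem exists_mem_sonineL_multiplier {v : Lp ℂ 2 (volume : Measure ℝ)} (hv : v ∈ sonineK 1)
    (α β : ℂ) :
    ∃ u ∈ sonineL 1, ∃ G₀ : ℂ → ℂ, Differentiable ℂ G₀ ∧ G₀ 0 = 0 ∧
      (∀ s : ℂ, 1 / 2 < s.re → s.re < 1 → G₀ s = rightMellin v s) ∧
      (∀ s : ℂ, 1 / 2 < s.re → s.re < 1 →
        rightMellin u s = G₀ s * ((s - α) * (s - β) / (s * (s - 1)))) ∧
      ∀ s : ℂ, s ≠ 1 → s ≠ 0 → Gammaℝ s ≠ 0 →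
        completedMellin (u : ℝ → ℂ) s =
          completedMellinEntire (v : ℝ → ℂ) s * ((s - α) * (s - β) / (s * (s - 1))) := by
  have h1 : (0 : ℝ) < 1 := one_pos
  -- entire continuations of `v̂` and `(𝓕v)^` (Thm. 2.1), vanishing at `0`
  obtain ⟨G₀, hG₀d, hG₀z, hG₀eq⟩ := (Burnol2004b_thm2_1_holds 1 h1).1 v hv
  have hFv : (𝓕 v : Lp ℂ 2 (volume : Measure ℝ)) ∈ sonineK 1 := fourier_mem_sonineK hv
  obtain ⟨H₀, hH₀d, hH₀z, hH₀eq⟩ := (Burnol2004b_thm2_1_holds 1 h1).1 _ hFv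
  have hG₀0 : G₀ 0 = 0 := by simpa using hG₀z 0
  have hH₀0 : H₀ 0 = 0 := by simpa using hH₀z 0
  -- `dslope` keeps differentiability
  have hdsG : Differentiable ℂ (dslope G₀ 0) :=
    differentiableOn_univ.1 ((Complex.differentiableOn_dslope Filter.univ_mem).2 hG₀d.differentiableOn)
  have hdsH : Differentiable ℂ (dslope H₀ 0) :=
    differentiableOn_univ.1 ((Complex.differentiableOn_dslope Filter.univ_mem).2 hH₀d.differentiableOn)
  have hrat : ∀ γ δ : ℂ,
      DifferentiableOn ℂ (fun s : ℂ ↦ (s - γ) * (s - δ) / (s - 1)) {s : ℂ | s ≠ 1} := fun γ δ ↦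
    ((differentiableOn_id.sub (differentiableOn_const γ)).mul
      (differentiableOn_id.sub (differentiableOn_const δ))).div
      (differentiableOn_id.sub (differentiableOn_const 1)) (fun s hs ↦ sub_ne_zero.2 hs)
  have hGd : DifferentiableOn ℂ (fun s ↦ dslope G₀ 0 s * ((s - α) * (s - β) / (s - 1)))
      {s : ℂ | s ≠ 1} := hdsG.differentiableOn.mul (hrat α β)
  have hHd : DifferentiableOn ℂ
      (fun s ↦ dslope H₀ 0 s * ((s - (1 - α)) * (s - (1 - β)) / (s - 1))) {s : ℂ | s ≠ 1} :=
    hdsH.differentiableOn.mul (hrat (1 - α) (1 - β))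
  -- the completed transforms
  have h𝒢v : ∀ s : ℂ, Gammaℝ s ≠ 0 → completedMellinEntire (v : ℝ → ℂ) s = Gammaℝ s * G₀ s :=
    fun s hs ↦ completedMellinEntire_eq_Gammaℝ_mul h1 hv hG₀d hG₀eq hs
  have h𝒢Fv : ∀ s : ℂ, Gammaℝ s ≠ 0 →
      completedMellinEntire ((𝓕 v : Lp ℂ 2 (volume : Measure ℝ)) : ℝ → ℂ) s = Gammaℝ s * H₀ s :=
    fun s hs ↦ completedMellinEntire_eq_Gammaℝ_mul h1 hFv hH₀d hH₀eq hs
  have hFEv : ∀ s : ℂ, completedMellinEntire ((𝓕 v : Lp ℂ 2 (volume : Measure ℝ)) : ℝ → ℂ) s =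
      completedMellinEntire (v : ℝ → ℂ) (1 - s) :=
    fun s ↦ congrFun (completedMellinEntire_fourier_eq_of_mem_sonineK h1 hv) s
  -- the functional equation `Γ_ℝ(s)H(s) = Γ_ℝ(1−s)G(1−s)` off the poles
  have hFE : ∀ s : ℂ, (∀ n : ℕ, s ≠ -2 * (n : ℂ)) → (∀ n : ℕ, s ≠ 1 + 2 * (n : ℂ)) →
      Gammaℝ s * (dslope H₀ 0 s * ((s - (1 - α)) * (s - (1 - β)) / (s - 1))) =
        Gammaℝ (1 - s) *
          (dslope G₀ 0 (1 - s) * (((1 - s) - α) * ((1 - s) - β) / ((1 - s) - 1))) := by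
    intro s hsn hsn1
    have hΓs : Gammaℝ s ≠ 0 := by
      intro h0
      obtain ⟨n, hn⟩ := Gammaℝ_eq_zero_iff.1 h0
      exact hsn n (by rw [hn]; ring)
    have hΓ1s : Gammaℝ (1 - s) ≠ 0 := by
      intro h0
      obtain ⟨n, hn⟩ := Gammaℝ_eq_zero_iff.1 h0
      exact hsn1 n (by linear_combination (-1 : ℂ) * hn)
    have hs0 : s ≠ 0 := by simpa using hsn 0
    have hs1 : s ≠ 1 := by simpa using hsn1 0
    have h1s0 : (1 : ℂ) - s ≠ 0 := sub_ne_zero.2 (Ne.symm hs1)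
    have hs1' : s - 1 ≠ 0 := sub_ne_zero.2 hs1
    have h1s1 : (1 : ℂ) - s - 1 ≠ 0 := by
      rw [sub_sub_cancel_left]; exact neg_ne_zero.2 hs0
    have key : H₀ s = Gammaℝ (1 - s) * G₀ (1 - s) / Gammaℝ s := by
      rw [eq_div_iff hΓs, mul_comm (H₀ s), ← h𝒢Fv s hΓs, hFEv s, h𝒢v (1 - s) hΓ1s]
    rw [dslope_of_ne _ hs0, dslope_of_ne _ h1s0, slope_def_field, slope_def_field, hG₀0, hH₀0,
      sub_zero, sub_zero, sub_zero, key]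
    field_simp
    ring
  -- Hardy data
  obtain ⟨FG, hFG, hFGeq⟩ := exists_isHardyRight_multiplier hv hG₀d hG₀0 hG₀eq α β
  obtain ⟨FH, hFH, hFHeq⟩ := exists_isHardyRight_multiplier hFv hH₀d hH₀0 hH₀eq (1 - α) (1 - β)
  -- Prop. 4.1 (ii)
  obtain ⟨u, huL, hu⟩ := Burnol2004b_prop4_1R_ii 1 h1
    (fun s ↦ dslope G₀ 0 s * ((s - α) * (s - β) / (s - 1)))
    (fun s ↦ dslope H₀ 0 s * ((s - (1 - α)) * (s - (1 - β)) / (s - 1)))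
    hGd hHd hFE ⟨FG, hFG, hFGeq⟩ ⟨FH, hFH, hFHeq⟩
  have hcontu : HasRightMellinContinuation (u : ℝ → ℂ)
      (fun s ↦ dslope G₀ 0 s * ((s - α) * (s - β) / (s - 1))) :=
    ⟨hGd, fun s hs hs' ↦ (hu s hs hs').symm⟩
  have hext : EqOn (rightMellinExt (u : ℝ → ℂ))
      (fun s ↦ dslope G₀ 0 s * ((s - α) * (s - β) / (s - 1))) {s : ℂ | s ≠ 1} :=
    (hasRightMellinContinuation_rightMellinExt_of_mem_sonineL h1 huL).eqOn hcontu
  refine ⟨u, huL, G₀, hG₀d, hG₀0, hG₀eq, fun s hs hs' ↦ ?_, fun s hs1 hs0 hΓ ↦ ?_⟩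
  · have hs0 : s ≠ 0 := fun h ↦ by rw [h, Complex.zero_re] at hs; linarith
    have hs1 : s - 1 ≠ 0 := by
      intro h
      have := congrArg Complex.re (sub_eq_zero.1 h)
      rw [Complex.one_re] at this
      linarith
    rw [hu s hs hs', dslope_of_ne _ hs0, slope_def_field, hG₀0, sub_zero, sub_zero]
    field_simp
  · have hs1' : s - 1 ≠ 0 := sub_ne_zero.2 hs1
    unfold completedMellin
    rw [hext hs1]
    beta_reduce
    rw [h𝒢v s hΓ, dslope_of_ne _ hs0, slope_def_field, hG₀0, sub_zero, sub_zero]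
    field_simp

/-! ## F. Annihilation: Prop. 6.1 at `a = 1` kills the multiplied vector -/

/-- **The annihilation step** ("The proof then proceeds as above and leads to `F(s) = 0`"). Assume the
`Y¹_{ρ,k}` are complete in `L_1` (Prop. 6.1 at `a = 1`). If `v ∈ K_1` and `α, β ∈ ℂ` are such that
`𝒢_v(s)·(s−α)(s−β)/(s(s−1))` vanishes to order `≥ m_ρ` at every non-trivial zero `ρ`, then `v = 0`:
the vector `u ∈ L_1` with `û = v̂·(s−α)(s−β)/(s(s−1))` (`exists_mem_sonineL_multiplier`) has
`M(u)^{(k)}(ρ) = 0` for all `k < m_ρ`, so its complex conjugate `ū` is Hermitian-orthogonal to every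
`Y¹_{ρ,k}`, hence `0`; then `v̂ ≡ 0` on the strip off `{α, β}`, so `𝒢_v ≡ 0` and `v = 0`.
[cite: Burnol2004b, Prop. 6.5, proof (arXiv:math/0203120v7 p. 16, TeX l.1312–1319)] -/
theorem eq_zero_of_le_analyticOrderAt_mul
    (h61 : IsCompleteSystemIn (sonineL 1) (burnolYSystem 1))
    {v : Lp ℂ 2 (volume : Measure ℝ)} (hv : v ∈ sonineK 1) (α β : ℂ)
    (hord : ∀ ρ ∈ ZetaZeros.riemannZetaNontrivialZeros,
      ((riemannZetaZeroOrder ρ).toNat : ℕ∞) ≤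
        analyticOrderAt (fun s ↦ completedMellinEntire (v : ℝ → ℂ) s *
          ((s - α) * (s - β) / (s * (s - 1)))) ρ) :
    v = 0 := by
  have h1 : (0 : ℝ) < 1 := one_pos
  obtain ⟨u, huL, G₀, hG₀d, hG₀0, hG₀eq, hustrip, hucm⟩ := exists_mem_sonineL_multiplier hv α β
  have h𝒢an : ∀ z : ℂ, AnalyticAt ℂ (completedMellinEntire (v : ℝ → ℂ)) z :=
    fun z ↦ (hasCompletedMellinEntire_of_mem_sonineK h1 hv).1.analyticAt z
  -- Step 1: every evaluation of `u` at an index of the system vanishes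
  have hueval : ∀ r : ZetaZeroIndex, burnolEval u r.1.1 r.1.2 = 0 := by
    intro r
    obtain ⟨hρ0, hρ1, hre0, -, -⟩ := zero_facts r.2.1
    have hev : completedMellin (u : ℝ → ℂ) =ᶠ[𝓝 r.1.1]
        fun s ↦ completedMellinEntire (v : ℝ → ℂ) s * ((s - α) * (s - β) / (s * (s - 1))) := by
      have hO : IsOpen {s : ℂ | s ≠ 1 ∧ s ≠ 0 ∧ 0 < s.re} :=
        isOpen_ne.inter (isOpen_ne.inter (isOpen_lt continuous_const Complex.continuous_re))
      filter_upwards [hO.mem_nhds ⟨hρ1, hρ0, hre0⟩] with s hs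
      exact hucm s hs.1 hs.2.1 (Gammaℝ_ne_zero_of_re_pos hs.2.2)
    have han : AnalyticAt ℂ (fun s ↦ completedMellinEntire (v : ℝ → ℂ) s *
        ((s - α) * (s - β) / (s * (s - 1)))) r.1.1 :=
      (h𝒢an _).mul (analyticAt_multiplier α β hρ0 hρ1)
    have hm : (((riemannZetaZeroOrder r.1.1).toNat : ℕ) : ℤ) = riemannZetaZeroOrder r.1.1 :=
      Int.toNat_of_nonneg (riemannZetaZeroOrder_nonneg hρ1)
    have hk : r.1.2 < (riemannZetaZeroOrder r.1.1).toNat := by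
      have h := r.2.2
      rw [← hm] at h
      exact_mod_cast h
    unfold burnolEval
    rw [hev.iteratedDeriv_eq r.1.2]
    exact (natCast_le_analyticOrderAt_iff_iteratedDeriv_eq_zero han).1 (hord r.1.1 r.2.1) _ hk
  -- Step 2: the complex conjugate of `u` is Hermitian-orthogonal to every `Y¹_{ρ,k}`, hence `u = 0`
  obtain ⟨x, hx⟩ := exists_conj u
  have hxL : x ∈ sonineL 1 := mem_sonineL_of_conj huL hx
  have hux : (u : ℝ → ℂ) =ᵐ[volume] fun t ↦ conj ((x : ℝ → ℂ) t) := by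
    filter_upwards [hx] with t ht
    rw [ht, Complex.conj_conj]
  have hinner : ∀ r : ZetaZeroIndex, ⟪burnolYSystem 1 r, x⟫_ℂ = 0 := by
    intro r
    have hY := isBurnolY_burnolYSystem h1 r
    have h2 : ⟪x, burnolYSystem 1 r⟫_ℂ = 0 := by
      rw [inner_eq_setIntegral_Ioi hxL.1 hY.1.1 hux]
      have h3 : ∫ t in Ioi (0 : ℝ), (burnolYSystem 1 r : ℝ → ℂ) t *
            (((2 : ℂ) • u : Lp ℂ 2 (volume : Measure ℝ)) : ℝ → ℂ) t
          = 2 * ∫ t in Ioi (0 : ℝ), (u : ℝ → ℂ) t * (burnolYSystem 1 r : ℝ → ℂ) t := by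
        rw [← integral_const_mul]
        refine integral_congr_ae ((ae_restrict_of_ae (Lp.coeFn_smul (2 : ℂ) u)).mono fun t ht ↦ ?_)
        simp only [ht, Pi.smul_apply, smul_eq_mul]
        ring
      rw [h3, hY.2 u huL, hueval r, mul_zero]
    rw [← inner_conj_symm, h2, map_zero]
  have hx0 : x = 0 := eq_zero_of_isCompleteSystemIn h61 hxL hinner
  have hu0 : (u : ℝ → ℂ) =ᵐ[volume] (0 : ℝ → ℂ) := by
    have hx0' : (x : ℝ → ℂ) =ᵐ[volume] (0 : ℝ → ℂ) := by
      rw [hx0]; exact Lp.coeFn_zero ℂ 2 (volume : Measure ℝ)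
    filter_upwards [hux, hx0'] with t ht1 ht2
    rw [ht1, ht2, Pi.zero_apply, map_zero]
  -- Step 3: `û ≡ 0` on the strip, hence `G₀ ≡ 0` there off `{α, β}`, hence everywhere
  have hmel0 : ∀ s : ℂ, rightMellin (u : ℝ → ℂ) s = 0 := by
    intro s
    unfold rightMellin mellin
    refine integral_eq_zero_of_ae ?_
    filter_upwards [ae_restrict_of_ae (s := Ioi (0 : ℝ)) hu0] with t ht
    simp [ht]
  have hG₀strip : ∀ s : ℂ, 1 / 2 < s.re → s.re < 1 → s ≠ α → s ≠ β → G₀ s = 0 := by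
    intro s hs hs' hα hβ
    have h := hustrip s hs hs'
    rw [hmel0] at h
    have hs0 : s ≠ 0 := fun h0 ↦ by rw [h0, Complex.zero_re] at hs; linarith
    have hs1 : s ≠ 1 := fun h0 ↦ by rw [h0, Complex.one_re] at hs'; linarith
    have hmult : (s - α) * (s - β) / (s * (s - 1)) ≠ 0 :=
      div_ne_zero (mul_ne_zero (sub_ne_zero.2 hα) (sub_ne_zero.2 hβ))
        (mul_ne_zero hs0 (sub_ne_zero.2 hs1))
    exact (mul_eq_zero.1 h.symm).resolve_right hmult
  -- a point of the strip avoiding `α` and `β`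
  set y : ℝ := |α.im| + |β.im| + 1 with hy
  have hyα : α.im < y := by
    have := le_abs_self α.im; have := abs_nonneg β.im; linarith
  have hyβ : β.im < y := by
    have := le_abs_self β.im; have := abs_nonneg α.im; linarith
  have hz₀α : (Complex.mk (3 / 4) y) ≠ α := fun h ↦ by
    have := congrArg Complex.im h
    change y = α.im at this
    linarith
  have hz₀β : (Complex.mk (3 / 4) y) ≠ β := fun h ↦ by
    have := congrArg Complex.im h
    change y = β.im at this
    linarith
  have hW : IsOpen ({s : ℂ | 1 / 2 < s.re ∧ s.re < 1} ∩ {s : ℂ | s ≠ α} ∩ {s : ℂ | s ≠ β}) :=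
    (((isOpen_lt continuous_const Complex.continuous_re).inter
      (isOpen_lt Complex.continuous_re continuous_const)).inter isOpen_ne).inter isOpen_ne
  have hz₀W : (Complex.mk (3 / 4) y) ∈
      ({s : ℂ | 1 / 2 < s.re ∧ s.re < 1} ∩ {s : ℂ | s ≠ α} ∩ {s : ℂ | s ≠ β}) :=
    ⟨⟨⟨by change (1 : ℝ) / 2 < 3 / 4; norm_num, by change (3 : ℝ) / 4 < 1; norm_num⟩, hz₀α⟩, hz₀β⟩
  have hG₀ev : G₀ =ᶠ[𝓝 (Complex.mk (3 / 4) y)] 0 := by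
    filter_upwards [hW.mem_nhds hz₀W] with s hs
    exact hG₀strip s hs.1.1.1 hs.1.1.2 hs.1.2 hs.2
  have hG₀zero : ∀ s : ℂ, G₀ s = 0 := fun s ↦
    (hG₀d.differentiableOn.analyticOnNhd isOpen_univ).eqOn_zero_of_preconnected_of_eventuallyEq_zero
      isPreconnected_univ (mem_univ _) hG₀ev (mem_univ s)
  -- Step 4: `𝒢_v ≡ 0`, hence `v = 0`
  have h𝒢zero : ∀ s : ℂ, completedMellinEntire (v : ℝ → ℂ) s = 0 := by
    have hev : completedMellinEntire (v : ℝ → ℂ) =ᶠ[𝓝 ((3 : ℂ) / 4)] 0 := by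
      have hre : (0 : ℝ) < ((3 : ℂ) / 4).re := by norm_num
      filter_upwards [(isOpen_lt continuous_const Complex.continuous_re).mem_nhds hre] with s hs
      rw [completedMellinEntire_eq_Gammaℝ_mul h1 hv hG₀d hG₀eq (Gammaℝ_ne_zero_of_re_pos hs),
        hG₀zero s, mul_zero, Pi.zero_apply]
    intro s
    exact ((hasCompletedMellinEntire_of_mem_sonineK h1 hv).1.differentiableOn.analyticOnNhd
      isOpen_univ).eqOn_zero_of_preconnected_of_eventuallyEq_zero isPreconnected_univ
      (mem_univ _) hev (mem_univ s)
  exact SonineMultiset.eq_zero_of_completedMellinEntire_eq_zero h1 hv h𝒢zero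

/-! ## G. Prop. 6.5, completeness clause (from Prop. 6.1 at `a = 1`) -/

/-- **Burnol 2004b, Prop. 6.5 — completeness of the shortened system, from Prop. 6.1 at `a = 1`.**
If the `Y¹_{ρ,k}` are complete in `L_1`, then for every admissible omission `{p, q}` (two top
evaluators at one zero, or the top evaluators at two distinct zeros) the system `(Z¹_r)_{r ≠ p, q}` is
complete in `K_1`: a vector `g ∈ K_1` Hermitian-orthogonal to the shortened list has conjugate `v` with
`M(v)^{(k)}(ρ) = 0` off `{p, q}`, i.e. `ord_ρ 𝒢_v ≥ m_ρ − [ρ = ρ_p] − [ρ = ρ_q]`; the multiplier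
`(s−ρ_p)(s−ρ_q)/(s(s−1))` supplies the missing orders, and `eq_zero_of_le_analyticOrderAt_mul` gives
`v = 0`, so `g = 0`. [cite: Burnol2004b, Prop. 6.5 (arXiv:math/0203120v7 p. 16, TeX l.1303–1319)] -/
theorem isCompleteSystemIn_shortened (h61 : IsCompleteSystemIn (sonineL 1) (burnolYSystem 1))
    {p q : ZetaZeroIndex} (hpq : IsAdmissibleOmission p q) :
    IsCompleteSystemIn (sonineK 1)
      (fun r : {r : ZetaZeroIndex // r ≠ p ∧ r ≠ q} ↦ burnolZSystem 1 r.1) := by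
  have h1 : (0 : ℝ) < 1 := one_pos
  let V : Submodule ℂ (Lp ℂ 2 (volume : Measure ℝ)) :=
    { carrier := sonineK 1
      add_mem' := fun hf hg ↦ add_mem_sonineK hf hg
      zero_mem' := zero_mem_sonineK 1
      smul_mem' := fun c _ hf ↦ smul_mem_sonineK c hf }
  have hV : (V : Set (Lp ℂ 2 (volume : Measure ℝ))) = sonineK 1 := rfl
  rw [← hV]
  refine isCompleteSystemIn_of_forall_inner_eq_zero V (by rw [hV]; exact isClosed_sonineK 1)
    (fun r ↦ burnolZSystem_mem_sonineK h1 r.1) fun g hg hinner ↦ ?_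
  have hgK : g ∈ sonineK 1 := hg
  obtain ⟨v, hv⟩ := exists_conj g
  have hvK : v ∈ sonineK 1 := mem_sonineK_of_conj hgK hv
  -- vanishing evaluations of `v` off `{p, q}`
  have hvan : ∀ r : ZetaZeroIndex, r ≠ p → r ≠ q → burnolEval v r.1.1 r.1.2 = 0 :=
    fun r hrp hrq ↦ burnolEval_conj_eq_zero_of_inner_eq_zero h1 hgK hv r (hinner ⟨r, hrp, hrq⟩)
  -- `v = 0`
  have hv0 : v = 0 := by
    refine eq_zero_of_le_analyticOrderAt_mul h61 hvK p.1.1 q.1.1 fun ρ hρ ↦ ?_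
    obtain ⟨hρ0, hρ1, -, -, -⟩ := zero_facts hρ
    -- the number of omitted evaluators at `ρ`
    set e : ℕ := (if ρ = p.1.1 then 1 else 0) + (if ρ = q.1.1 then 1 else 0) with he
    set M : ℕ := (riemannZetaZeroOrder ρ).toNat with hM
    have hMm : (M : ℤ) = riemannZetaZeroOrder ρ := Int.toNat_of_nonneg (riemannZetaZeroOrder_nonneg hρ1)
    -- the evaluations of `v` at `ρ` vanish below `M - e`
    have hvρ : ∀ k < M - e, burnolEval v ρ k = 0 := by
      intro k hk
      have hkM : (k : ℤ) < riemannZetaZeroOrder ρ := by rw [← hMm]; omega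
      let r : ZetaZeroIndex := ⟨(ρ, k), hρ, hkM⟩
      have hrp : r ≠ p := by
        intro hr
        have h' : (ρ, k) = p.1 := congrArg Subtype.val hr
        have hρp : ρ = p.1.1 := (congrArg Prod.fst h').trans rfl
        have hkp : k = p.1.2 := (congrArg Prod.snd h').trans rfl
        have he1 : 1 ≤ e := by rw [he, if_pos hρp]; omega
        have h2 := hpq.2.1
        rw [← hkp, ← hρp, ← hMm] at h2
        omega
      have hrq : r ≠ q := by
        intro hr
        have h' : (ρ, k) = q.1 := congrArg Subtype.val hr
        have hρq : ρ = q.1.1 := (congrArg Prod.fst h').trans rfl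
        have hkq : k = q.1.2 := (congrArg Prod.snd h').trans rfl
        rcases hpq.2.2 with ⟨hqp, hk2⟩ | ⟨hqp, hk1⟩
        · have hρp : ρ = p.1.1 := hρq.trans hqp
          have he2 : e = 2 := by rw [he, if_pos hρp, if_pos hρq]
          rw [← hkq, ← hρq, ← hMm] at hk2
          omega
        · have he1 : 1 ≤ e := by rw [he, if_pos hρq]; omega
          rw [← hkq, ← hρq, ← hMm] at hk1
          omega
      exact hvan r hrp hrq
    have hordG : ((M - e : ℕ) : ℕ∞) ≤ analyticOrderAt (completedMellinEntire (v : ℝ → ℂ)) ρ :=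
      natCast_le_analyticOrderAt_completedMellinEntire h1 hvK hρ hvρ
    have hordm : (e : ℕ∞) ≤
        analyticOrderAt (fun s : ℂ ↦ (s - p.1.1) * (s - q.1.1) / (s * (s - 1))) ρ :=
      le_analyticOrderAt_multiplier p.1.1 q.1.1 hρ0 hρ1
    have han : AnalyticAt ℂ (completedMellinEntire (v : ℝ → ℂ)) ρ :=
      (hasCompletedMellinEntire_of_mem_sonineK h1 hvK).1.analyticAt ρ
    show (M : ℕ∞) ≤ analyticOrderAt ((completedMellinEntire (v : ℝ → ℂ)) *
      fun s : ℂ ↦ (s - p.1.1) * (s - q.1.1) / (s * (s - 1))) ρ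
    rw [analyticOrderAt_mul han (analyticAt_multiplier p.1.1 q.1.1 hρ0 hρ1)]
    calc (M : ℕ∞) ≤ ((M - e + e : ℕ) : ℕ∞) := by exact_mod_cast le_tsub_add
      _ = ((M - e : ℕ) : ℕ∞) + (e : ℕ∞) := by push_cast; ring
      _ ≤ _ := add_le_add hordG hordm
  -- `g = 0`
  have hv0' : (v : ℝ → ℂ) =ᵐ[volume] (0 : ℝ → ℂ) := by
    rw [hv0]; exact Lp.coeFn_zero ℂ 2 (volume : Measure ℝ)
  refine Lp.ext ?_
  filter_upwards [hv, hv0', Lp.coeFn_zero ℂ 2 (volume : Measure ℝ)] with t ht1 ht2 ht3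
  rw [ht3]
  have : conj ((g : ℝ → ℂ) t) = 0 := by rw [← ht1, ht2, Pi.zero_apply]
  simpa using this

/-! ## H. Prop. 6.5, first clause: the full system `(Z¹_{ρ,k})` is not minimal -/

/-- **Burnol 2004b, Prop. 6.5, first clause — "The vectors `Z¹_{ρ,k}` are not minimal in `K_1`"**, from
the completeness of the admissibly shortened systems: `ζ` has two distinct non-trivial zeros `ρ₁ ≠ ρ₂`
(Hardy: infinitely many on the critical line), `{(ρ₁, m_{ρ₁}−1), (ρ₂, m_{ρ₂}−1)}` is an admissible
omission, and `Z¹_{ρ₁,m_{ρ₁}−1} ∈ K_1` lies in the closed span of the shortened system, a fortiori in the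
closed span of all the other evaluators. [cite: Burnol2004b, Prop. 6.5 (arXiv:math/0203120v7 p. 16, TeX l.1303–1310); Hardy1914, C. R. Acad. Sci. Paris 158 (1914), 1012–1014] -/
theorem not_isMinimalSystem_of_complete
    (hcomp : ∀ p q : ZetaZeroIndex, IsAdmissibleOmission p q →
      IsCompleteSystemIn (sonineK 1)
        (fun r : {r : ZetaZeroIndex // r ≠ p ∧ r ≠ q} ↦ burnolZSystem 1 r.1)) :
    ¬ IsMinimalSystem (burnolZSystem 1) := by
  intro hmin
  -- two distinct zeros on the critical line
  have hinf := Hardy.riemannZeta_zeros_on_critical_line_infinite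
  obtain ⟨t₁, ht₁⟩ := hinf.nonempty
  obtain ⟨t₂, ht₂, ht₂₁⟩ := (hinf.sdiff (Set.finite_singleton t₁)).nonempty
  have ht₂₁' : t₂ ≠ t₁ := ht₂₁
  have hmem : ∀ t : ℝ, riemannZeta (1 / 2 + t * I) = 0 →
      (1 / 2 + t * I : ℂ) ∈ ZetaZeros.riemannZetaNontrivialZeros := fun t ht ↦
    mem_riemannZetaNontrivialZeros_iff_holds.2 ⟨ht, by simp, by norm_num [Complex.add_re]⟩
  have hρ₁ := hmem t₁ ht₁
  have hρ₂ := hmem t₂ ht₂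
  have hne : (1 / 2 + t₁ * I : ℂ) ≠ 1 / 2 + t₂ * I := by
    intro h
    have := congrArg Complex.im h
    simp at this
    exact ht₂₁' this.symm
  -- the top indices at `ρ₁`, `ρ₂`
  have hidx : ∀ {ρ : ℂ}, ρ ∈ ZetaZeros.riemannZetaNontrivialZeros →
      (((riemannZetaZeroOrder ρ - 1).toNat : ℕ) : ℤ) = riemannZetaZeroOrder ρ - 1 := by
    intro ρ hρ
    obtain ⟨-, hρ1, -, -, -⟩ := zero_facts hρ
    have hpos : 0 < riemannZetaZeroOrder ρ :=
      (riemannZetaZeroOrder_pos_iff hρ1).2 (mem_riemannZetaNontrivialZeros_iff_holds.1 hρ).1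
    exact Int.toNat_of_nonneg (by omega)
  have hp2 : (((riemannZetaZeroOrder (1 / 2 + t₁ * I) - 1).toNat : ℕ) : ℤ) <
      riemannZetaZeroOrder (1 / 2 + t₁ * I) := by rw [hidx hρ₁]; omega
  have hq2 : (((riemannZetaZeroOrder (1 / 2 + t₂ * I) - 1).toNat : ℕ) : ℤ) <
      riemannZetaZeroOrder (1 / 2 + t₂ * I) := by rw [hidx hρ₂]; omega
  let p : ZetaZeroIndex :=
    ⟨(1 / 2 + t₁ * I, (riemannZetaZeroOrder (1 / 2 + t₁ * I) - 1).toNat), hρ₁, hp2⟩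
  let q : ZetaZeroIndex :=
    ⟨(1 / 2 + t₂ * I, (riemannZetaZeroOrder (1 / 2 + t₂ * I) - 1).toNat), hρ₂, hq2⟩
  have hadm : IsAdmissibleOmission p q := by
    refine ⟨fun h ↦ hne (congrArg (fun r : ZetaZeroIndex ↦ r.1.1) h), ?_, Or.inr ⟨Ne.symm hne, ?_⟩⟩
    · show (((riemannZetaZeroOrder (1 / 2 + t₁ * I) - 1).toNat : ℕ) : ℤ) + 1 =
        riemannZetaZeroOrder (1 / 2 + t₁ * I)
      rw [hidx hρ₁]; ring
    · show (((riemannZetaZeroOrder (1 / 2 + t₂ * I) - 1).toNat : ℕ) : ℤ) + 1 =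
        riemannZetaZeroOrder (1 / 2 + t₂ * I)
      rw [hidx hρ₂]; ring
  have hc := hcomp p q hadm
  have hZp := hc.2 (burnolZSystem_mem_sonineK one_pos p)
  have hsub : (Submodule.span ℂ
      (Set.range fun r : {r : ZetaZeroIndex // r ≠ p ∧ r ≠ q} ↦ burnolZSystem 1 r.1) :
        Set (Lp ℂ 2 (volume : Measure ℝ))) ⊆
      (Submodule.span ℂ (burnolZSystem 1 '' {j | j ≠ p}) : Set (Lp ℂ 2 (volume : Measure ℝ))) :=
    Submodule.span_mono (by rintro _ ⟨r, rfl⟩; exact ⟨r.1, r.2.1, rfl⟩)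
  exact hmin p (closure_mono hsub hZp)

end BurnolShortenedComplete

/-! ## I. The doors to Prop. 6.5 as typed -/

open BurnolShortenedComplete in
/-- **Burnol 2004b, Prop. 6.5 AS TYPED, from the `a = 1` clause of Prop. 6.1 and the minimality of the
shortened systems.** The first two clauses ("not minimal"; "spanned … even after omitting …") are
proved here from the completeness of the `Y¹_{ρ,k}` in `L_1` ("The proof then proceeds as above" —
the argument of Prop. 6.1 at `a = 1`); the third ("This shortened system is then a minimal system")
enters as the hypothesis `hmin`. [cite: Burnol2004b, Prop. 6.5 (arXiv:math/0203120v7 p. 16, TeX l.1303–1328)] -/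
theorem Burnol2004b_prop6_5_of_complete_of_minimal
    (h61 : IsCompleteSystemIn (sonineL 1) (burnolYSystem 1))
    (hmin : ∀ p q : ZetaZeroIndex, IsAdmissibleOmission p q →
      IsMinimalSystem (fun r : {r : ZetaZeroIndex // r ≠ p ∧ r ≠ q} ↦ burnolZSystem 1 r.1)) :
    Burnol2004b_prop6_5 :=
  ⟨not_isMinimalSystem_of_complete (fun _ _ h ↦ isCompleteSystemIn_shortened h61 h),
    fun p q h ↦ ⟨isCompleteSystemIn_shortened h61 h, hmin p q h⟩⟩

/-- **Burnol 2004b, Prop. 6.5 from Prop. 6.1 (named fact `Burnol2004b_prop6_1`, used at `a = 1` only)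
and the minimality of the shortened systems.** `Burnol2004b_prop6_5_holds` is then one line once
`Burnol2004b_prop6_1` is discharged and the minimality clause is proved (neither is done here).
[cite: Burnol2004b, Prop. 6.5 and Prop. 6.1 (arXiv:math/0203120v7 pp. 15–16, TeX l.1203–1239, 1303–1328)] -/
theorem Burnol2004b_prop6_5_of_prop6_1_of_minimal (h61 : Burnol2004b_prop6_1)
    (hmin : ∀ p q : ZetaZeroIndex, IsAdmissibleOmission p q →
      IsMinimalSystem (fun r : {r : ZetaZeroIndex // r ≠ p ∧ r ≠ q} ↦ burnolZSystem 1 r.1)) :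
    Burnol2004b_prop6_5 :=
  Burnol2004b_prop6_5_of_complete_of_minimal (h61 1 le_rfl) hmin

end Literature.NumberTheory.LFunctions
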